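import Mathlib
import Summits.NavierStokesRegularity.NavierStokesRegularity.Theorems.FilamentSkeletonRssTangentSkeletonNearStraightLPartnerSymbol
import Summits.NavierStokesRegularity.NavierStokesRegularity.Theorems.FilamentSkeletonRssTangentSkeletonNearStraightLBesselSharp

/-!
# Swirl-band decoupling, ODD entries: `∫₀^∞ σ·sin(kσ)(σ²+D²)^{-3/2} dσ = D⁻¹·(kD)K₀(kD) ≤ D⁻¹(1+kD)e^{−kD}`
# (`TangentSkeletonNearStraightL`, stmt-NavierStokesRegularity-23320; companion of (R♯-sw) `SwirlBandDecouplingL`)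

The partner block of the linearised tangency operator (the strategist's `B = −P_n∇u_k·Y` plus the `Y′ × (X_j − X_k)` term,
`Cruxes/SkeletonJ1L/STRATEGY-CENSUS.md` PART III) has, besides the EVEN kernel entries `((d²+σ²)+μ²)^{−3/2}` treated in
`…TangentSkeletonNearStraightLSwirlBandDecoupling` (p826065: symbol `2kK₁(kD)/D ≤ (2/D²)(1+kD)e^{−kD}`, `D² = d²+μ²`), ODD entries
`σ·((d²+σ²)+μ²)^{−3/2}`, whose sine symbol is the classical `x·K₀(x)`.  In the tree's vocabulary (`Numerics.Eint p =
∫₀^∞ e^{−t}e^{−p/t}dt/t = 2K₀(2√p)`, `Numerics.Cint p = 2√p·K₁(2√p)`) this file proves, def-free: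

* `sqrt_mul_Eint_le_Cint` : `√p·E(p) ≤ C(p)` (`K₀ ≤ K₁`) — AM–GM on `2C(p) = ∫ e^{−t−p/t}(1 + p/t²)` (the tree's `integral_E2_eq`);
* `integral_Ioi_mul_sin_mul_gauss` : `∫₀^∞ h sin(xh)e^{−th²} dh = (x/4t)√(π/t)e^{−x²/4t}` (from the tree's exact-derivative
  lemma `integral_Ioi_deriv_sin_mul_exp` and the Gaussian cosine integral);
* `integral_mul_sin_mul_inv_rpow_three_halves` : `∫₀^∞ h·sin(xh)(1+h²)^{−3/2} dh = (x/2)·E(x²/4)` (Γ(3/2)-subordination + Fubini);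
* `abs_integral_mul_sin_mul_inv_rpow_le` : `… ≤ (1+x)e^{−x}` for `x ≥ 0` (via `√pE ≤ C` and `Cint_le_sharp`, p825980);
* `swirlBand_decoupling_odd` : for `0 < μ ≤ d`, `k ≥ 0`,
  `|∫₀^∞ σ sin(kσ)((d²+σ²)+μ²)^{−3/2} dσ| ≤ (√(d²+μ²))⁻¹(1 + k√(d²+μ²))e^{−k√(d²+μ²)}`.

With p826065 this makes EVERY `(·)^{−3/2}`-order entry of the partner symbol exponentially small in the swirl band `k ≥ μ⁻¹`;
the `(·)^{−5/2}` (kernel-gradient) entries follow the same way by Γ(5/2)-subordination (`∫₀^∞ t e^{−t−p/t}dt = C + pE`) and are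
left to the next hand (recipe in the hand's exit report).
HONEST FRAMING: MODEL-level lemmas of the linear theory of a HYPOTHETICAL filament skeleton on the NEGATIVE side of a MODEL route;
no registered stub of 23320 is proved, `TangentSkeletonNearStraightL` stays OPEN, nothing here bears on Navier–Stokes regularity
or blow-up.  `--supports stmt-NavierStokesRegularity-23320`.
-/

set_option linter.dupNamespace false

noncomputable section

open Real Set MeasureTheory Filter Topology

namespace Summit.NavierStokesRegularity.NavierStokesRegularity.Theorems.TangentSkeletonNearStraightLSwirlBand

open Summit.NavierStokesRegularity.NavierStokesRegularity.Theorems.AnalyticStripLiaSymbol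
open Summit.NavierStokesRegularity.NavierStokesRegularity.Theorems.AnalyticStripLiaSymbol.Numerics

/-! ## §1  `√p·E(p) ≤ C(p)` (i.e. `K₀ ≤ K₁`) -/

/-- **`√p·E(p) ≤ C(p)`** for `p > 0`, i.e. `K₀(x) ≤ K₁(x)`: by the symmetry `t ↦ p/t`
(`∫₀^∞ e^{−t−p/t} p/t² dt = C(p)`, the tree's `integral_E2_eq`) one has `2C(p) = ∫₀^∞ e^{−t−p/t}(1 + p/t²) dt`, and
`1 + p/t² ≥ 2√p/t`. [folklore] -/
theorem sqrt_mul_Eint_le_Cint {p : ℝ} (hp : 0 < p) : √p * Eint p ≤ Cint p := by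
  have hE2 := integral_E2_eq hp
  have hI1 : IntegrableOn (fun t : ℝ => Real.exp (-t) * Real.exp (-(p / t))) (Ioi 0) := integrableOn_fC hp.le
  have hI2 : IntegrableOn (fun t : ℝ => Real.exp (-t) * Real.exp (-(p / t)) / t ^ 2) (Ioi 0) :=
    integrableOn_E2_integrand hp
  -- `2 C = ∫ fC (1 + p/t²)`
  have h2C : 2 * Cint p = ∫ t in Ioi (0:ℝ), (Real.exp (-t) * Real.exp (-(p / t))
      + p * (Real.exp (-t) * Real.exp (-(p / t)) / t ^ 2)) := by
    rw [integral_add hI1 (hI2.const_mul p), integral_const_mul, hE2]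
    unfold Cint
    have hp0 : p ≠ 0 := hp.ne'
    field_simp
    ring
  -- pointwise AM–GM: `2√p · fE ≤ fC + p fC/t²`
  have hpt : ∀ t ∈ Ioi (0:ℝ), 2 * √p * (Real.exp (-t) * Real.exp (-(p / t)) / t)
      ≤ Real.exp (-t) * Real.exp (-(p / t)) + p * (Real.exp (-t) * Real.exp (-(p / t)) / t ^ 2) := by
    intro t ht
    have ht : (0:ℝ) < t := ht
    have hf : 0 < Real.exp (-t) * Real.exp (-(p / t)) := by positivity
    have hsp : √p ^ 2 = p := Real.sq_sqrt hp.le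
    -- divide by fC: `2√p/t ≤ 1 + p/t²` ⟸ `(√p/t - 1)² ≥ 0`... in cleared form
    have key : 2 * √p * t ≤ t ^ 2 + p := by nlinarith [sq_nonneg (t - √p)]
    have : 2 * √p * (1 / t) ≤ 1 + p * (1 / t ^ 2) := by
      rw [show 2 * √p * (1 / t) = 2 * √p * t / t ^ 2 by field_simp,
        show 1 + p * (1 / t ^ 2) = (t ^ 2 + p) / t ^ 2 by field_simp]
      exact div_le_div_of_nonneg_right key (by positivity)
    calc 2 * √p * (Real.exp (-t) * Real.exp (-(p / t)) / t)
        = (Real.exp (-t) * Real.exp (-(p / t))) * (2 * √p * (1 / t)) := by ring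
      _ ≤ (Real.exp (-t) * Real.exp (-(p / t))) * (1 + p * (1 / t ^ 2)) :=
          mul_le_mul_of_nonneg_left this hf.le
      _ = Real.exp (-t) * Real.exp (-(p / t)) + p * (Real.exp (-t) * Real.exp (-(p / t)) / t ^ 2) := by ring
  have hIE : IntegrableOn (fun t : ℝ => Real.exp (-t) * Real.exp (-(p / t)) / t) (Ioi 0) := integrableOn_E_integrand hp
  have hmono : ∫ t in Ioi (0:ℝ), 2 * √p * (Real.exp (-t) * Real.exp (-(p / t)) / t)
      ≤ ∫ t in Ioi (0:ℝ), (Real.exp (-t) * Real.exp (-(p / t)) + p * (Real.exp (-t) * Real.exp (-(p / t)) / t ^ 2)) :=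
    setIntegral_mono_on (hIE.const_mul (2 * √p)) (hI1.add (hI2.const_mul p)) measurableSet_Ioi hpt
  rw [integral_const_mul, ← h2C] at hmono
  unfold Eint
  linarith


/-! ## §2  The half-line Gaussian odd moment `∫₀^∞ h·sin(xh)·e^{−th²} dh = (x/(4t))·√(π/t)·e^{−x²/(4t)}` -/

/-- Integrability of `cos(xh)·e^{−th²}` on `(0,∞)`. [folklore] -/
theorem integrableOn_cos_mul_gauss {t : ℝ} (ht : 0 < t) (x : ℝ) :
    IntegrableOn (fun h : ℝ => Real.cos (x * h) * Real.exp (-t * h ^ 2)) (Ioi 0) := by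
  refine Integrable.mono' ((integrable_exp_neg_mul_sq ht).integrableOn) (by fun_prop) ?_
  refine Filter.Eventually.of_forall fun h => ?_
  rw [Real.norm_eq_abs, abs_mul, abs_of_pos (Real.exp_pos _)]
  calc |Real.cos (x * h)| * Real.exp (-t * h ^ 2) ≤ 1 * Real.exp (-t * h ^ 2) := by
        gcongr; exact Real.abs_cos_le_one _
    _ = Real.exp (-t * h ^ 2) := one_mul _

/-- Integrability of `h·sin(xh)·e^{−th²}` on `(0,∞)`. [folklore] -/
theorem integrableOn_mul_sin_mul_gauss {t : ℝ} (ht : 0 < t) (x : ℝ) :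
    IntegrableOn (fun h : ℝ => h * Real.sin (x * h) * Real.exp (-t * h ^ 2)) (Ioi 0) := by
  refine Integrable.mono' ((integrable_mul_exp_neg_mul_sq ht).norm.integrableOn) (by fun_prop) ?_
  refine Filter.Eventually.of_forall fun h => ?_
  rw [Real.norm_eq_abs, Real.norm_eq_abs, abs_mul, abs_mul, abs_mul, abs_of_pos (Real.exp_pos _)]
  calc |h| * |Real.sin (x * h)| * Real.exp (-t * h ^ 2) ≤ |h| * 1 * Real.exp (-t * h ^ 2) := by
        gcongr; exact Real.abs_sin_le_one _
    _ = |h| * Real.exp (-t * h ^ 2) := by ring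

/-- **Odd Gaussian moment**: `∫₀^∞ h·sin(xh)·e^{−th²} dh = (x/(4t))·√(π/t)·e^{−x²/(4t)}` (the exact derivative
`d/dh[sin(xh)e^{−th²}]` integrates to zero — the tree's `integral_Ioi_deriv_sin_mul_exp` — and the cosine integral is Gaussian). [folklore] -/
theorem integral_Ioi_mul_sin_mul_gauss {t : ℝ} (ht : 0 < t) (x : ℝ) :
    ∫ h in Ioi (0:ℝ), h * Real.sin (x * h) * Real.exp (-t * h ^ 2)
      = x / (4 * t) * √(π / t) * Real.exp (-x ^ 2 / (4 * t)) := by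
  have h0 := integral_Ioi_deriv_sin_mul_exp ht x
  have hdec : ∀ h : ℝ, (x * Real.cos (x * h) - 2 * t * h * Real.sin (x * h)) * Real.exp (-t * h ^ 2)
      = x * (Real.cos (x * h) * Real.exp (-t * h ^ 2)) - 2 * t * (h * Real.sin (x * h) * Real.exp (-t * h ^ 2)) := by
    intro h; ring
  simp_rw [hdec] at h0
  rw [integral_sub ((integrableOn_cos_mul_gauss ht x).const_mul x) ((integrableOn_mul_sin_mul_gauss ht x).const_mul _),
    integral_const_mul, integral_const_mul, integral_Ioi_cos_mul_exp_neg_mul_sq ht x] at h0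
  set I := ∫ h in Ioi (0:ℝ), h * Real.sin (x * h) * Real.exp (-t * h ^ 2) with hI
  set E := Real.exp (-x ^ 2 / (4 * t)) with hE
  set R := √(π / t) with hR
  have ht0 : t ≠ 0 := ht.ne'
  have : I = x * (R / 2 * E) / (2 * t) := by
    rw [eq_div_iff (by positivity)]; linarith
  rw [this]; field_simp; ring

/-! ## §3  The odd transform `∫₀^∞ h·sin(xh)·(1+h²)^{−3/2} dh = (x/2)·E(x²/4)` (`= x·K₀(x)`) -/

/-- Continuity of the subordinated odd integrand. [folklore] -/
theorem continuous_sinSubordinand (x : ℝ) : Continuous (fun p : ℝ × ℝ => p.1 * Real.sin (x * p.1)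
    * ((Real.Gamma (3 / 2))⁻¹ * (p.2 ^ (1 / 2 : ℝ) * Real.exp (-((1 + p.1 ^ 2) * p.2))))) := by
  have hr : Continuous fun p : ℝ × ℝ => p.2 ^ (1 / 2 : ℝ) :=
    (Real.continuous_rpow_const (by norm_num)).comp continuous_snd
  fun_prop

/-- `h·(1+h²)^{−3/2} ≤ (1+h²)⁻¹` for `h ≥ 0`. [folklore] -/
theorem mul_inv_rpow_le {h : ℝ} (hh : 0 ≤ h) : h * ((1 + h ^ 2) ^ (3 / 2 : ℝ))⁻¹ ≤ (1 + h ^ 2)⁻¹ := by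
  have hpos : 0 < 1 + h ^ 2 := by positivity
  have hsplit : (1 + h ^ 2) ^ (3 / 2 : ℝ) = (1 + h ^ 2) * √(1 + h ^ 2) := by
    rw [show (3:ℝ) / 2 = 1 + 1 / 2 by norm_num, Real.rpow_add hpos, Real.rpow_one, Real.sqrt_eq_rpow]
  have hh' : h ≤ √(1 + h ^ 2) := by
    have := Real.sqrt_le_sqrt (show h ^ 2 ≤ 1 + h ^ 2 by nlinarith)
    rwa [Real.sqrt_sq hh] at this
  have hs0 : 0 < √(1 + h ^ 2) := by positivity
  rw [hsplit, mul_inv, ← mul_assoc, mul_comm h, mul_assoc]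
  calc (1 + h ^ 2)⁻¹ * (h * (√(1 + h ^ 2))⁻¹) ≤ (1 + h ^ 2)⁻¹ * 1 := by
        gcongr
        rw [mul_inv_le_iff₀ hs0, one_mul]; exact hh'
    _ = (1 + h ^ 2)⁻¹ := mul_one _

/-- Integrability of the subordinated odd integrand on `(0,∞) × (0,∞)`. [folklore] -/
theorem integrable_sinSubordinand (x : ℝ) :
    Integrable (fun p : ℝ × ℝ => p.1 * Real.sin (x * p.1)
      * ((Real.Gamma (3 / 2))⁻¹ * (p.2 ^ (1 / 2 : ℝ) * Real.exp (-((1 + p.1 ^ 2) * p.2)))))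
      ((volume.restrict (Ioi (0:ℝ))).prod (volume.restrict (Ioi (0:ℝ)))) := by
  have hmeas : AEStronglyMeasurable (fun p : ℝ × ℝ => p.1 * Real.sin (x * p.1)
      * ((Real.Gamma (3 / 2))⁻¹ * (p.2 ^ (1 / 2 : ℝ) * Real.exp (-((1 + p.1 ^ 2) * p.2)))))
      ((volume.restrict (Ioi (0:ℝ))).prod (volume.restrict (Ioi (0:ℝ)))) :=
    (continuous_sinSubordinand x).aestronglyMeasurable
  rw [integrable_prod_iff hmeas]
  constructor
  · refine Filter.Eventually.of_forall fun h => ?_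
    exact ((integrableOn_rpow_half_mul_exp h).const_mul ((Real.Gamma (3 / 2))⁻¹)).const_mul (h * Real.sin (x * h))
  · have hnorm : ∀ h : ℝ, ∫ t in Ioi (0:ℝ), ‖(fun p : ℝ × ℝ => p.1 * Real.sin (x * p.1)
      * ((Real.Gamma (3 / 2))⁻¹ * (p.2 ^ (1 / 2 : ℝ) * Real.exp (-((1 + p.1 ^ 2) * p.2))))) (h, t)‖
        = |h * Real.sin (x * h)| * ((1 + h ^ 2) ^ (3 / 2 : ℝ))⁻¹ := by
      intro h
      have hG : 0 < (Real.Gamma (3 / 2))⁻¹ := inv_pos.mpr (Real.Gamma_pos_of_pos (by norm_num))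
      have hpt : ∀ t ∈ Ioi (0:ℝ), ‖(fun p : ℝ × ℝ => p.1 * Real.sin (x * p.1)
          * ((Real.Gamma (3 / 2))⁻¹ * (p.2 ^ (1 / 2 : ℝ) * Real.exp (-((1 + p.1 ^ 2) * p.2))))) (h, t)‖
            = |h * Real.sin (x * h)| * ((Real.Gamma (3 / 2))⁻¹ * (t ^ (1 / 2 : ℝ) * Real.exp (-((1 + h ^ 2) * t)))) := by
        intro t ht
        simp only [Real.norm_eq_abs, abs_mul]
        rw [abs_of_pos hG, abs_of_nonneg (Real.rpow_nonneg (le_of_lt ht) _), abs_of_pos (Real.exp_pos _)]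
      rw [setIntegral_congr_fun measurableSet_Ioi hpt, integral_const_mul, integral_const_mul,
        inv_rpow_three_halves_eq_integral h]
    simp_rw [hnorm]
    have hdom : Integrable (fun h : ℝ => (1 + h ^ 2)⁻¹) (volume.restrict (Ioi (0:ℝ))) :=
      integrable_inv_one_add_sq.integrableOn
    refine hdom.mono' ?_ ?_
    · refine ((Continuous.abs ?_).mul ?_).aestronglyMeasurable
      · exact continuous_id.mul (Real.continuous_sin.comp (continuous_const.mul continuous_id))
      · refine Continuous.inv₀ ?_ (fun h => (Real.rpow_pos_of_pos (by positivity) _).ne')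
        exact (continuous_const.add (continuous_pow 2)).rpow_const fun _ => Or.inr (by norm_num)
    · rw [ae_restrict_iff' measurableSet_Ioi]
      refine Filter.Eventually.of_forall fun h (hh : 0 < h) => ?_
      rw [Real.norm_eq_abs, abs_mul, abs_abs,
        abs_of_pos (inv_pos.mpr (Real.rpow_pos_of_pos (by positivity) _)), abs_mul, abs_of_pos hh]
      calc h * |Real.sin (x * h)| * ((1 + h ^ 2) ^ (3 / 2 : ℝ))⁻¹ ≤ h * 1 * ((1 + h ^ 2) ^ (3 / 2 : ℝ))⁻¹ := by
            gcongr; exact Real.abs_sin_le_one _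
        _ ≤ (1 + h ^ 2)⁻¹ := by rw [mul_one]; exact mul_inv_rpow_le hh.le


/-- For `t > 0`: `Γ(3/2)⁻¹·t^{1/2}e^{−t}·(x/(4t))√(π/t)e^{−x²/(4t)} = (x/2)·e^{−t}e^{−(x²/4)/t}/t`. [folklore] -/
theorem subordination_weight_odd_eq {t : ℝ} (ht : 0 < t) (x : ℝ) :
    (Real.Gamma (3 / 2))⁻¹ * (t ^ (1 / 2 : ℝ) * Real.exp (-t)) * (x / (4 * t) * √(π / t) * Real.exp (-x ^ 2 / (4 * t)))
      = x / 2 * (Real.exp (-t) * Real.exp (-((x ^ 2 / 4) / t)) / t) := by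
  rw [Gamma_three_halves]
  have hsq : t ^ (1 / 2 : ℝ) = √t := by rw [Real.sqrt_eq_rpow]
  have hpi : 0 < π := Real.pi_pos
  have h1 : √(π / t) = √π / √t := Real.sqrt_div (le_of_lt hpi) t
  have hst : 0 < √t := Real.sqrt_pos.mpr ht
  have hsp : 0 < √π := Real.sqrt_pos.mpr hpi
  have hx : -x ^ 2 / (4 * t) = -((x ^ 2 / 4) / t) := by field_simp
  have htt : √t * √t = t := Real.mul_self_sqrt ht.le
  rw [hsq, h1, hx]
  field_simp
  ring

/-- **Odd transform of `(1+h²)^{-3/2}`**: `∫₀^∞ h·sin(xh)·(1+h²)^{−3/2} dh = (x/2)·E(x²/4)` where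
`E(p) = ∫₀^∞ e^{−t}e^{−p/t} dt/t = 2K₀(2√p)` is the tree's `Numerics.Eint` — i.e. the classical `x·K₀(x)`.
Γ(3/2)-subordination, Fubini on `(0,∞)²`, odd Gaussian moment. [folklore; Watson §6.16] -/
theorem integral_mul_sin_mul_inv_rpow_three_halves (x : ℝ) :
    ∫ h in Ioi (0:ℝ), h * Real.sin (x * h) * ((1 + h ^ 2) ^ (3 / 2 : ℝ))⁻¹ = x / 2 * Eint (x ^ 2 / 4) := by
  have hL : ∫ h in Ioi (0:ℝ), h * Real.sin (x * h) * ((1 + h ^ 2) ^ (3 / 2 : ℝ))⁻¹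
      = ∫ h in Ioi (0:ℝ), ∫ t in Ioi (0:ℝ), (fun p : ℝ × ℝ => p.1 * Real.sin (x * p.1)
          * ((Real.Gamma (3 / 2))⁻¹ * (p.2 ^ (1 / 2 : ℝ) * Real.exp (-((1 + p.1 ^ 2) * p.2))))) (h, t) := by
    refine integral_congr_ae (Filter.Eventually.of_forall fun h => ?_)
    simp only []
    rw [integral_const_mul, integral_const_mul, inv_rpow_three_halves_eq_integral h]
  have hint : Integrable (Function.uncurry fun h t => (fun p : ℝ × ℝ => p.1 * Real.sin (x * p.1)
      * ((Real.Gamma (3 / 2))⁻¹ * (p.2 ^ (1 / 2 : ℝ) * Real.exp (-((1 + p.1 ^ 2) * p.2))))) (h, t))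
      ((volume.restrict (Ioi (0:ℝ))).prod (volume.restrict (Ioi (0:ℝ)))) := integrable_sinSubordinand x
  have hswap := integral_integral_swap hint
  rw [hL, hswap]
  have hinner : ∀ t ∈ Ioi (0:ℝ), (∫ h in Ioi (0:ℝ), (fun p : ℝ × ℝ => p.1 * Real.sin (x * p.1)
      * ((Real.Gamma (3 / 2))⁻¹ * (p.2 ^ (1 / 2 : ℝ) * Real.exp (-((1 + p.1 ^ 2) * p.2))))) (h, t))
        = x / 2 * (Real.exp (-t) * Real.exp (-((x ^ 2 / 4) / t)) / t) := by
    intro t ht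
    have ht : (0:ℝ) < t := ht
    have hrw : ∀ h : ℝ, (fun p : ℝ × ℝ => p.1 * Real.sin (x * p.1)
        * ((Real.Gamma (3 / 2))⁻¹ * (p.2 ^ (1 / 2 : ℝ) * Real.exp (-((1 + p.1 ^ 2) * p.2))))) (h, t)
          = ((Real.Gamma (3 / 2))⁻¹ * (t ^ (1 / 2 : ℝ) * Real.exp (-t)))
            * (h * Real.sin (x * h) * Real.exp (-t * h ^ 2)) := by
      intro h
      simp only []
      have : Real.exp (-((1 + h ^ 2) * t)) = Real.exp (-t) * Real.exp (-t * h ^ 2) := by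
        rw [← Real.exp_add]; congr 1; ring
      rw [this]; ring
    simp_rw [hrw]
    rw [integral_const_mul, integral_Ioi_mul_sin_mul_gauss ht x, subordination_weight_odd_eq ht x]
  rw [setIntegral_congr_fun measurableSet_Ioi hinner, integral_const_mul]
  rfl

/-! ## §4  The bound `x·K₀(x) ≤ (1+x)e^{−x}` and the scaled odd symbol -/

/-- `|∫₀^∞ h·sin(xh)(1+h²)^{−3/2} dh| ≤ (1+x)·e^{−x}` for `x ≥ 0` (`= (x/2)E(x²/4) = √p·E(p) ≤ C(p) ≤ (1+2√p)e^{−2√p}`,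
`p = x²/4`). [folklore] -/
theorem abs_integral_mul_sin_mul_inv_rpow_le {x : ℝ} (hx : 0 ≤ x) :
    |∫ h in Ioi (0:ℝ), h * Real.sin (x * h) * ((1 + h ^ 2) ^ (3 / 2 : ℝ))⁻¹| ≤ (1 + x) * Real.exp (-x) := by
  rw [integral_mul_sin_mul_inv_rpow_three_halves x]
  rcases hx.eq_or_lt with h0 | hxpos
  · rw [← h0]; simp
  have hp : 0 < x ^ 2 / 4 := by positivity
  have hroot : √(x ^ 2 / 4) = x / 2 := by
    rw [show x ^ 2 / 4 = (x / 2) ^ 2 by ring]; exact Real.sqrt_sq (by linarith)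
  have h1 := sqrt_mul_Eint_le_Cint hp
  have h2 := Cint_le_sharp hp.le
  rw [hroot] at h1 h2
  rw [abs_of_nonneg (mul_nonneg (by linarith) (Eint_nonneg _))]
  calc x / 2 * Eint (x ^ 2 / 4) ≤ Cint (x ^ 2 / 4) := h1
    _ ≤ (1 + 2 * (x / 2)) * Real.exp (-(2 * (x / 2))) := h2
    _ = (1 + x) * Real.exp (-x) := by ring_nf

/-- **Scaled odd symbol**: for `D > 0`, `k ≥ 0`,
`|∫₀^∞ σ·sin(kσ)·(σ²+D²)^{−3/2} dσ| ≤ D⁻¹·(1 + kD)·e^{−kD}` (the value is `D⁻¹·(kD)K₀(kD)`). [folklore] -/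
theorem abs_integral_mul_sin_mul_inv_rpow_scale_le {D k : ℝ} (hD : 0 < D) (hk : 0 ≤ k) :
    |∫ σ in Ioi (0:ℝ), σ * Real.sin (k * σ) * ((σ ^ 2 + D ^ 2) ^ (3 / 2 : ℝ))⁻¹|
      ≤ D⁻¹ * (1 + k * D) * Real.exp (-(k * D)) := by
  have hsub := integral_comp_mul_left_Ioi
    (fun σ : ℝ => σ * Real.sin (k * σ) * ((σ ^ 2 + D ^ 2) ^ (3 / 2 : ℝ))⁻¹) 0 hD
  rw [mul_zero, smul_eq_mul] at hsub
  have hg : ∀ h : ℝ, (D * h) * Real.sin (k * (D * h)) * (((D * h) ^ 2 + D ^ 2) ^ (3 / 2 : ℝ))⁻¹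
      = (D ^ 2)⁻¹ * (h * Real.sin ((k * D) * h) * ((1 + h ^ 2) ^ (3 / 2 : ℝ))⁻¹) := by
    intro h
    rw [rpow_scale hD h, mul_inv, show k * (D * h) = (k * D) * h by ring]
    field_simp
  simp_rw [hg] at hsub
  rw [integral_const_mul] at hsub
  have hD0 : D ≠ 0 := hD.ne'
  set A := ∫ h in Ioi (0:ℝ), h * Real.sin ((k * D) * h) * ((1 + h ^ 2) ^ (3 / 2 : ℝ))⁻¹ with hA
  set G := ∫ σ in Ioi (0:ℝ), σ * Real.sin (k * σ) * ((σ ^ 2 + D ^ 2) ^ (3 / 2 : ℝ))⁻¹ with hG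
  have hGA : G = D⁻¹ * A := by
    have h' : G = D * ((D ^ 2)⁻¹ * A) := by rw [hsub]; field_simp
    rw [h']; field_simp
  rw [hGA, abs_mul, abs_of_pos (inv_pos.mpr hD), mul_assoc]
  exact mul_le_mul_of_nonneg_left (abs_integral_mul_sin_mul_inv_rpow_le (by positivity)) (inv_pos.mpr hD).le

/-- **(R♯-sw), odd entry** — companion of `swirlBand_decoupling` in the census's kernel notation: for `0 < μ ≤ d`,
`k ≥ 0`, `|∫₀^∞ σ·sin(kσ)·((d²+σ²)+μ²)^{−3/2} dσ| ≤ (√(d²+μ²))⁻¹·(1 + k√(d²+μ²))·e^{−k√(d²+μ²)}` — the odd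
(`X′ × (·)`-type) entries of the partner block are exponentially small in the swirl band as well. [folklore] -/
theorem swirlBand_decoupling_odd : ∀ (d μ k : ℝ), 0 < μ → μ ≤ d → 0 ≤ k →
    |∫ σ in Ioi (0:ℝ), σ * Real.sin (k * σ) * ((d ^ 2 + σ ^ 2) + μ ^ 2) ^ (-(3:ℝ) / 2)|
      ≤ (√(d ^ 2 + μ ^ 2))⁻¹ * (1 + k * √(d ^ 2 + μ ^ 2)) * Real.exp (-k * √(d ^ 2 + μ ^ 2)) := by
  intro d μ k hμ _ hk
  have hD2 : 0 < d ^ 2 + μ ^ 2 := by positivity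
  have hD : 0 < √(d ^ 2 + μ ^ 2) := Real.sqrt_pos.mpr hD2
  have hsq : √(d ^ 2 + μ ^ 2) ^ 2 = d ^ 2 + μ ^ 2 := Real.sq_sqrt hD2.le
  have hfun : ∀ σ ∈ Ioi (0:ℝ), σ * Real.sin (k * σ) * ((d ^ 2 + σ ^ 2) + μ ^ 2) ^ (-(3:ℝ) / 2)
      = σ * Real.sin (k * σ) * ((σ ^ 2 + √(d ^ 2 + μ ^ 2) ^ 2) ^ (3 / 2 : ℝ))⁻¹ := by
    intro σ _
    rw [hsq, show (d ^ 2 + σ ^ 2) + μ ^ 2 = σ ^ 2 + (d ^ 2 + μ ^ 2) by ring,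
      show (-(3:ℝ) / 2) = -(3 / 2 : ℝ) by norm_num, Real.rpow_neg (by positivity)]
  rw [setIntegral_congr_fun measurableSet_Ioi hfun, neg_mul]
  exact abs_integral_mul_sin_mul_inv_rpow_scale_le hD hk

end Summit.NavierStokesRegularity.NavierStokesRegularity.Theorems.TangentSkeletonNearStraightLSwirlBand
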